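import Summits.Ventures.PercRepro.GenQSevenFiveCorners

/-!
# PercRepro — corner (iii) of the `(7, 5)` layer `t = 4` split like the `(6, 4)` residue: «hyperplane + line» and
«generic» (night-4, gen 2)

`SevenFiveCornerThree` (`GenQSevenFiveCorners.lean`) is the type-`4` balance on the rank-`5` flats in `𝔉_5` with no
hyperplane trace of `≥ g − 2` points.  Exactly as the `(6, 4)` residue of record splits its type-`4` half into
`PlaneLineFour` (a plane trace whose complement is collinear) and Theorem G (`Generic`: every plane trace has a
complement of rank `≥ 3`), corner (iii) splits along the rank of the complements of the rank-`4` traces: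

* `SevenFiveCornerThreeLine` — some rank-`4` flat `Z` has `ρ(G ∖ Z) ≤ 2` (then `|G ∖ Z| ≥ 3`: «hyperplane + line»);
* `SevenFiveCornerThreeGeneric` — every rank-`4` flat `Z` has `ρ(G ∖ Z) ≥ 3`;
* `sevenFiveCornerThree_of_line_generic`: the two give `SevenFiveCornerThree`.

A pure case split (no counting); it fixes the statements of the two remaining pieces in the vocabulary of the tree.
Imports `GenQSevenFiveCorners`.
-/

namespace PercRepro.GenQ

open Finset ThmH PerFlat SixFour ThmN

/-- **Corner (iii-a), «hyperplane + line»**: the type-`4` balance on the rank-`5` flats in `𝔉_5` with no hyperplane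
trace of `≥ g − 2` points and some rank-`4` flat `Z` with `ρ(G ∖ Z) ≤ 2`. -/
def SevenFiveCornerThreeLine : Prop :=
  ∀ {β : Type} [DecidableEq β] (M : Matroid β) [M.Finite] (G : Finset β), Simple M → G ∈ flatsQ M 5 →
    TwoHyp M G 5 → ¬ HypPlusLeTwo M G 5 →
    (∃ Z ∈ flatsQ M 4, M.eRk ((G \ Z : Finset β) : Set β) ≤ 2) → 0 ≤ Jq M G 5 4

/-- **Corner (iii-b), «generic»**: the type-`4` balance on the rank-`5` flats in `𝔉_5` with no hyperplane trace of
`≥ g − 2` points all of whose rank-`4` traces have a complement of rank `≥ 3`. -/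
def SevenFiveCornerThreeGeneric : Prop :=
  ∀ {β : Type} [DecidableEq β] (M : Matroid β) [M.Finite] (G : Finset β), Simple M → G ∈ flatsQ M 5 →
    TwoHyp M G 5 → ¬ HypPlusLeTwo M G 5 →
    (∀ Z ∈ flatsQ M 4, (3 : ℕ∞) ≤ M.eRk ((G \ Z : Finset β) : Set β)) → 0 ≤ Jq M G 5 4

/-- **Corner (iii) from its two halves.** -/
theorem sevenFiveCornerThree_of_line_generic (hL : SevenFiveCornerThreeLine) (hG : SevenFiveCornerThreeGeneric) :
    SevenFiveCornerThree := by
  intro β _ M _ G hs hGf hF hH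
  by_cases hline : ∃ Z ∈ flatsQ M 4, M.eRk ((G \ Z : Finset β) : Set β) ≤ 2
  · exact hL M G hs hGf hF hH hline
  · apply hG M G hs hGf hF hH
    intro Z hZ
    by_contra hlt
    push Not at hlt
    apply hline
    refine ⟨Z, hZ, ?_⟩
    obtain ⟨k, hk, -⟩ := eRk_eq_nat M (G \ Z)
    rw [hk] at hlt ⊢
    have : k < 3 := by exact_mod_cast hlt
    exact_mod_cast (by omega : k ≤ 2)

/-- **C-025 at `(7, 5)` on every finite matroid from the five pieces**: corners (i), (ii), (iii-a), (iii-b) and the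
low layers. -/
theorem rls_seven_five_of_five_pieces {α : Type} [DecidableEq α] (h1 : SevenFiveCornerOne) (h2 : SevenFiveCornerTwo)
    (h3a : SevenFiveCornerThreeLine) (h3b : SevenFiveCornerThreeGeneric) (hlow : SevenFiveLowLayers)
    (M : Matroid α) [M.Finite] : RLS M 7 5 :=
  rls_seven_five_of_corners h1 h2 (sevenFiveCornerThree_of_line_generic h3a h3b) hlow M

end PercRepro.GenQ
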